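import Summits.CriticalPhenomena.PercolationContinuityZ3.Theorems.PercNearOneGluingAdditiveGluingSwitchClosure
import Summits.CriticalPhenomena.PercolationContinuityZ3.Theorems.PercNearOneGluingAdditiveGluingKernelPinDesignated
import Summits.CriticalPhenomena.PercolationContinuityZ3.Theorems.PercNearOneGluingAdditiveGluingOneBond
import HarnessLib

/-! # Crux `PercNearOneGluing.AdditiveGluing` (stmt-CriticalPhenomena-4576) — the SINGLE-EDGE SWITCH: every minimiser of the
# two-point function with ONE block edge deleted is a good designation (exchange-certificate form, seat (d) round 4)

Support file (`--supports stmt-CriticalPhenomena-4576`); no definitions, no named facts.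

`μ_u = prodBernoulli u`; relays `A ∋ b`; a block `S`; block goodness of `S` at a designation `d` (worst selection)
`BG(u,S,d) :  μ_u(d↔b) + μ_u(d↮b, d↔S, S↔b) ≤ μ_u(S↔b) + Σ_{W∩A=∅} μ_u(K_S = W) · min_{a∈A} μ_u(a ↔ b in Wᶜ)`.
Fix a pair `e = s(x,y)` with `x ∈ S ∌ y` and write `u₀ = u[e ↦ 0]`, `u₁ = u[e ↦ 1]`.

* `edgeSw_slack_decomp` (**one-edge layer identity**): `slack_BG(u,S,d) = (1 − u e)·slack_BG(u₀,S,d) + (u e)·slack_BG(u₁,S,d)`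
  — the one-bond decomposition (`stub_oneBondDecomp_k15`) applied to the four block events; the pocket factor
  `μ(a ↔ b in Wᶜ)`, `W ⊇ S ∋ x`, does not see `e` (`prodBernoulli_real_eq_of_determinedBy`).
* `edgeSw_blockSlack_insert_sure` (**a surely attached vertex may be dropped from the block**): if `w e = 1` then
  `BG(w, insert y S, d) → BG(w, S, d)` (on `{e open}` the block events of `S` and of `insert y S` coincide, and `{e closed}`
  is `μ_w`-null).
* `blockGood_of_edgeLayers`: `BG(u₀,S,d) ∧ BG(u₀, insert y S, d) → BG(u,S,d)` (glue invariance
  `blockSlack_eq_of_agree_offBlock` moves the second hypothesis from `u₀` to `u₁`, where `e` is sure).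
* `blockGood_of_edgeMin` (**edge-deletion minimisers are good**): if `d ∈ A` minimises `μ_{u₀}(· ↔ b)` over `A` and every
  block disjoint from `A` is `d`-good in `u₀` (the inner induction hypothesis of the cone line: `u₀` has fewer positive
  pairs), then `BG(u,S,d)`: the layer `insert y S` is Kozma–Nitzan's Lemma 5 in block form when `y ∈ A`
  (`relayNoDrift_designated_le_reach`) and the hypothesis otherwise.
* `blockGood_of_edgeSwitch` (**the closure**): hence `BG(u,S,a₀)` as soon as `τ_{u/S}(a₀) ≤ τ_{u/S}(d)` for ONE block edge
  `e` and ONE minimiser `d` of `μ_{u−e}(· ↔ b)` (down-set `blockGood_mono_designated`).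
Census of this seat (exact engine lab/eng.py): the edge switch closes all 22 glued-dominant-minimiser records of kit job
j034795 (the residual class of `additiveGluing_of_gdmCert2` / `additiveGluing_of_gdmExch`), in each of them with `d = a₀`.
[cite: KozmaNitzan2024, §3.2 Definition p. 12, Thms 4–5 pp. 12–14, Lemma 5 p. 13, §5.3 p. 34 (one-edge interpolation)]
-/

namespace Summit.CriticalPhenomena.PercolationContinuityZ3.Theorems

open MeasureTheory Set
open Literature.Probability.LatticeModels (prodBernoulli)
open Literature.Probability.Percolation (BondConfig openConn openConnIn openGraph openCluster)
open scoped BigOperators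

noncomputable section
open Classical

section EdgeSwitch

open Literature.Probability.LatticeModels Literature.Probability.Percolation

variable {n : ℕ}

/-- The pocket factor `μ(a ↔ b in Wᶜ)` of a pocket `W ∋ x` does not depend on the weight of a pair at `x`. [folklore] -/
theorem edgeSw_pocketFactor_update (u : Sym2 (Fin n) → unitInterval) (W : Finset (Fin n)) (x y a b : Fin n)
    (hxW : x ∈ W) (t : unitInterval) :
    (prodBernoulli (Function.update u s(x, y) t)).real (openConnIn ((W : Set (Fin n))ᶜ) a b) =
      (prodBernoulli u).real (openConnIn ((W : Set (Fin n))ᶜ) a b) := by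
  refine prodBernoulli_real_eq_of_determinedBy _ u (fun e he => ?_) (offObs_determinedBy_openConnIn_compl W a b)
    MeasurableSet.of_discrete
  have he' : ∀ v ∈ e, v ∉ W := (Finset.mem_filter.1 (Finset.mem_coe.1 he)).2
  have hne : e ≠ s(x, y) := fun h => he' x (h ▸ Sym2.mem_mk_left x y) hxW
  exact Function.update_of_ne hne _ _

/-- **One-edge layer identity for the block slack.**  For a pair `e = s(x,y)` with `x ∈ S`:
`slack_BG(u,S,d) = (1 − u e)·slack_BG(u[e↦0],S,d) + (u e)·slack_BG(u[e↦1],S,d)`.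
[cite: KozmaNitzan2024, §5.3 p. 34 (linearity in one edge weight), §3.2 Definition p. 12] -/
theorem edgeSw_slack_decomp (u : Sym2 (Fin n) → unitInterval) (A S : Finset (Fin n)) (b d x y : Fin n) (hb : b ∈ A)
    (hxS : x ∈ S) :
    (prodBernoulli u).real (⋃ v ∈ S, openConn v b)
        + (∑ W ∈ (Finset.univ : Finset (Finset (Fin n))).filter (fun W => Disjoint W A),
            (prodBernoulli u).real {ω : BondConfig (Fin n) | ∀ z : Fin n, (z ∈ W ↔ ω ∈ ⋃ v ∈ S, openConn v z)}
              * A.inf' ⟨b, hb⟩ (fun a => (prodBernoulli u).real (openConnIn ((W : Set (Fin n))ᶜ) a b)))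
        - ((prodBernoulli u).real (openConn d b)
            + (prodBernoulli u).real ((openConn d b)ᶜ ∩ (⋃ v ∈ S, openConn d v) ∩ (⋃ v ∈ S, openConn v b)))
      = (1 - (u s(x, y) : ℝ)) *
          ((prodBernoulli (Function.update u s(x, y) 0)).real (⋃ v ∈ S, openConn v b)
            + (∑ W ∈ (Finset.univ : Finset (Finset (Fin n))).filter (fun W => Disjoint W A),
                (prodBernoulli (Function.update u s(x, y) 0)).real
                    {ω : BondConfig (Fin n) | ∀ z : Fin n, (z ∈ W ↔ ω ∈ ⋃ v ∈ S, openConn v z)}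
                  * A.inf' ⟨b, hb⟩ (fun a => (prodBernoulli (Function.update u s(x, y) 0)).real
                      (openConnIn ((W : Set (Fin n))ᶜ) a b)))
            - ((prodBernoulli (Function.update u s(x, y) 0)).real (openConn d b)
                + (prodBernoulli (Function.update u s(x, y) 0)).real
                    ((openConn d b)ᶜ ∩ (⋃ v ∈ S, openConn d v) ∩ (⋃ v ∈ S, openConn v b))))
        + (u s(x, y) : ℝ) *
          ((prodBernoulli (Function.update u s(x, y) 1)).real (⋃ v ∈ S, openConn v b)
            + (∑ W ∈ (Finset.univ : Finset (Finset (Fin n))).filter (fun W => Disjoint W A),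
                (prodBernoulli (Function.update u s(x, y) 1)).real
                    {ω : BondConfig (Fin n) | ∀ z : Fin n, (z ∈ W ↔ ω ∈ ⋃ v ∈ S, openConn v z)}
                  * A.inf' ⟨b, hb⟩ (fun a => (prodBernoulli (Function.update u s(x, y) 1)).real
                      (openConnIn ((W : Set (Fin n))ᶜ) a b)))
            - ((prodBernoulli (Function.update u s(x, y) 1)).real (openConn d b)
                + (prodBernoulli (Function.update u s(x, y) 1)).real
                    ((openConn d b)ᶜ ∩ (⋃ v ∈ S, openConn d v) ∩ (⋃ v ∈ S, openConn v b)))) := by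
  set e : Sym2 (Fin n) := s(x, y) with he
  set u₀ := Function.update u e 0 with hu₀
  set u₁ := Function.update u e 1 with hu₁
  have hR := stub_oneBondDecomp_k15 n u e (⋃ v ∈ S, openConn v b)
  have hT := stub_oneBondDecomp_k15 n u e (openConn d b)
  have hG := stub_oneBondDecomp_k15 n u e ((openConn d b)ᶜ ∩ (⋃ v ∈ S, openConn d v) ∩ (⋃ v ∈ S, openConn v b))
  -- pockets, termwise
  have hP : ∀ W ∈ (Finset.univ : Finset (Finset (Fin n))).filter (fun W => Disjoint W A),
      (prodBernoulli u).real {ω : BondConfig (Fin n) | ∀ z : Fin n, (z ∈ W ↔ ω ∈ ⋃ v ∈ S, openConn v z)}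
          * A.inf' ⟨b, hb⟩ (fun a => (prodBernoulli u).real (openConnIn ((W : Set (Fin n))ᶜ) a b))
        = (1 - (u e : ℝ)) * ((prodBernoulli u₀).real {ω : BondConfig (Fin n) | ∀ z : Fin n, (z ∈ W ↔ ω ∈ ⋃ v ∈ S, openConn v z)}
          * A.inf' ⟨b, hb⟩ (fun a => (prodBernoulli u₀).real (openConnIn ((W : Set (Fin n))ᶜ) a b)))
          + (u e : ℝ) * ((prodBernoulli u₁).real {ω : BondConfig (Fin n) | ∀ z : Fin n, (z ∈ W ↔ ω ∈ ⋃ v ∈ S, openConn v z)}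
          * A.inf' ⟨b, hb⟩ (fun a => (prodBernoulli u₁).real (openConnIn ((W : Set (Fin n))ᶜ) a b))) := by
    intro W _
    by_cases hSW : S ⊆ W
    · have hxW : x ∈ W := hSW hxS
      have h0 : A.inf' ⟨b, hb⟩ (fun a => (prodBernoulli u₀).real (openConnIn ((W : Set (Fin n))ᶜ) a b))
          = A.inf' ⟨b, hb⟩ (fun a => (prodBernoulli u).real (openConnIn ((W : Set (Fin n))ᶜ) a b)) :=
        Finset.inf'_congr ⟨b, hb⟩ rfl fun a _ => edgeSw_pocketFactor_update u W x y a b hxW 0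
      have h1 : A.inf' ⟨b, hb⟩ (fun a => (prodBernoulli u₁).real (openConnIn ((W : Set (Fin n))ᶜ) a b))
          = A.inf' ⟨b, hb⟩ (fun a => (prodBernoulli u).real (openConnIn ((W : Set (Fin n))ᶜ) a b)) :=
        Finset.inf'_congr ⟨b, hb⟩ rfl fun a _ => edgeSw_pocketFactor_update u W x y a b hxW 1
      rw [h0, h1, stub_oneBondDecomp_k15 n u e {ω : BondConfig (Fin n) | ∀ z : Fin n, (z ∈ W ↔ ω ∈ ⋃ v ∈ S, openConn v z)}]
      ring
    · obtain ⟨s₀, hs₀S, hs₀W⟩ := Finset.not_subset.1 hSW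
      rw [blockPocket_eq_empty S W s₀ hs₀S hs₀W]
      simp only [measureReal_empty, zero_mul, mul_zero, add_zero]
  have hPsum : (∑ W ∈ (Finset.univ : Finset (Finset (Fin n))).filter (fun W => Disjoint W A),
        (prodBernoulli u).real {ω : BondConfig (Fin n) | ∀ z : Fin n, (z ∈ W ↔ ω ∈ ⋃ v ∈ S, openConn v z)}
          * A.inf' ⟨b, hb⟩ (fun a => (prodBernoulli u).real (openConnIn ((W : Set (Fin n))ᶜ) a b)))
      = (1 - (u e : ℝ)) * (∑ W ∈ (Finset.univ : Finset (Finset (Fin n))).filter (fun W => Disjoint W A),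
          (prodBernoulli u₀).real {ω : BondConfig (Fin n) | ∀ z : Fin n, (z ∈ W ↔ ω ∈ ⋃ v ∈ S, openConn v z)}
            * A.inf' ⟨b, hb⟩ (fun a => (prodBernoulli u₀).real (openConnIn ((W : Set (Fin n))ᶜ) a b)))
        + (u e : ℝ) * (∑ W ∈ (Finset.univ : Finset (Finset (Fin n))).filter (fun W => Disjoint W A),
          (prodBernoulli u₁).real {ω : BondConfig (Fin n) | ∀ z : Fin n, (z ∈ W ↔ ω ∈ ⋃ v ∈ S, openConn v z)}
            * A.inf' ⟨b, hb⟩ (fun a => (prodBernoulli u₁).real (openConnIn ((W : Set (Fin n))ᶜ) a b))) := by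
    rw [Finset.mul_sum, Finset.mul_sum, ← Finset.sum_add_distrib]
    exact Finset.sum_congr rfl hP
  rw [hPsum, hR, hT, hG]
  ring

/-- If the pair `e` is sure (`w e = 1`), two events that agree on `{e open}` have the same probability. [folklore] -/
theorem edgeSw_real_eq_of_sure (w : Sym2 (Fin n) → unitInterval) (e : Sym2 (Fin n)) (hwe : w e = 1)
    (E E' : Set (BondConfig (Fin n)))
    (h : ∀ ω : BondConfig (Fin n), e ∈ ω → (ω ∈ E ↔ ω ∈ E')) :
    (prodBernoulli w).real E = (prodBernoulli w).real E' := by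
  have key : ∀ F : Set (BondConfig (Fin n)), (prodBernoulli w).real F = (prodBernoulli w).real (F ∩ {ω | e ∈ ω}) := by
    intro F
    have hU : F = (F ∩ {ω | e ∉ ω}) ∪ (F ∩ {ω | e ∈ ω}) := by
      ext ω; simp only [mem_union, mem_inter_iff, mem_setOf_eq]; tauto
    have hD : Disjoint (F ∩ {ω : BondConfig (Fin n) | e ∉ ω}) (F ∩ {ω | e ∈ ω}) := by
      rw [Set.disjoint_left]
      rintro ω ⟨-, h1⟩ ⟨-, h2⟩
      exact h1 h2
    conv_lhs => rw [hU]
    rw [measureReal_union hD (Set.toFinite _).measurableSet, goodStepEI_real_inter_closed_eq, hwe]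
    simp
  rw [key E, key E']
  congr 1
  ext ω
  simp only [mem_inter_iff, mem_setOf_eq]
  constructor
  · rintro ⟨hE, heω⟩
    exact ⟨(h ω heω).1 hE, heω⟩
  · rintro ⟨hE', heω⟩
    exact ⟨(h ω heω).2 hE', heω⟩

/-- If the pair `s(x,y)` is open, `x ∈ S`, then a vertex is joined to `insert y S` iff it is joined to `S`. [folklore] -/
theorem edgeSw_biUnion_insert_iff (S : Finset (Fin n)) (x y z : Fin n) (hxS : x ∈ S) (hxy : x ≠ y)
    (ω : BondConfig (Fin n)) (he : s(x, y) ∈ ω) :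
    (ω ∈ ⋃ v ∈ insert y S, (openConn v z : Set (BondConfig (Fin n)))) ↔ (ω ∈ ⋃ v ∈ S, openConn v z) := by
  constructor
  · intro h
    obtain ⟨v, hv, hvz⟩ := Set.mem_iUnion₂.1 h
    rcases Finset.mem_insert.1 hv with rfl | hvS
    · have hxv : ω ∈ openConn x v :=
        (SimpleGraph.Adj.reachable ((openGraph_adj ω x v).2 ⟨he, hxy⟩) : (openGraph ω).Reachable x v)
      exact Set.mem_iUnion₂.2 ⟨x, hxS, blockGrowth_openConn_trans hxv hvz⟩
    · exact Set.mem_iUnion₂.2 ⟨v, hvS, hvz⟩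
  · intro h
    obtain ⟨v, hvS, hvz⟩ := Set.mem_iUnion₂.1 h
    exact Set.mem_iUnion₂.2 ⟨v, Finset.mem_insert_of_mem hvS, hvz⟩

/-- Same, for connections INTO the block: `d ↔ insert y S` iff `d ↔ S` when `s(x,y)` is open, `x ∈ S`. [folklore] -/
theorem edgeSw_biUnion_insert_iff' (S : Finset (Fin n)) (x y d : Fin n) (hxS : x ∈ S) (hxy : x ≠ y)
    (ω : BondConfig (Fin n)) (he : s(x, y) ∈ ω) :
    (ω ∈ ⋃ v ∈ insert y S, (openConn d v : Set (BondConfig (Fin n)))) ↔ (ω ∈ ⋃ v ∈ S, openConn d v) := by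
  constructor
  · intro h
    obtain ⟨v, hv, hdv⟩ := Set.mem_iUnion₂.1 h
    rcases Finset.mem_insert.1 hv with rfl | hvS
    · have hvx : ω ∈ openConn v x :=
        blockGrowth_openConn_symm
          (SimpleGraph.Adj.reachable ((openGraph_adj ω x v).2 ⟨he, hxy⟩) : (openGraph ω).Reachable x v)
      exact Set.mem_iUnion₂.2 ⟨x, hxS, blockGrowth_openConn_trans hdv hvx⟩
    · exact Set.mem_iUnion₂.2 ⟨v, hvS, hdv⟩
  · intro h
    obtain ⟨v, hvS, hdv⟩ := Set.mem_iUnion₂.1 h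
    exact Set.mem_iUnion₂.2 ⟨v, Finset.mem_insert_of_mem hvS, hdv⟩

/-- **A surely attached vertex may be dropped from the block.**  If `w s(x,y) = 1` with `x ∈ S`, `x ≠ y`, then
`BG(w, insert y S, d) → BG(w, S, d)` (in fact the two slacks are equal). [cite: KozmaNitzan2024, §3.1 Remark p. 5 (gluing)] -/
theorem edgeSw_blockSlack_insert_sure (w : Sym2 (Fin n) → unitInterval) (A S : Finset (Fin n)) (b d x y : Fin n)
    (hb : b ∈ A) (hxS : x ∈ S) (hxy : x ≠ y) (hwe : w s(x, y) = 1)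
    (h : (prodBernoulli w).real (openConn d b)
          + (prodBernoulli w).real
              ((openConn d b)ᶜ ∩ (⋃ v ∈ insert y S, openConn d v) ∩ (⋃ v ∈ insert y S, openConn v b))
        ≤ (prodBernoulli w).real (⋃ v ∈ insert y S, openConn v b)
          + (∑ W ∈ (Finset.univ : Finset (Finset (Fin n))).filter (fun W => Disjoint W A),
              (prodBernoulli w).real
                  {ω : BondConfig (Fin n) | ∀ z : Fin n, (z ∈ W ↔ ω ∈ ⋃ v ∈ insert y S, openConn v z)}
                * A.inf' ⟨b, hb⟩ (fun a => (prodBernoulli w).real (openConnIn ((W : Set (Fin n))ᶜ) a b)))) :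
    (prodBernoulli w).real (openConn d b)
          + (prodBernoulli w).real
              ((openConn d b)ᶜ ∩ (⋃ v ∈ S, openConn d v) ∩ (⋃ v ∈ S, openConn v b))
        ≤ (prodBernoulli w).real (⋃ v ∈ S, openConn v b)
          + (∑ W ∈ (Finset.univ : Finset (Finset (Fin n))).filter (fun W => Disjoint W A),
              (prodBernoulli w).real
                  {ω : BondConfig (Fin n) | ∀ z : Fin n, (z ∈ W ↔ ω ∈ ⋃ v ∈ S, openConn v z)}
                * A.inf' ⟨b, hb⟩ (fun a => (prodBernoulli w).real (openConnIn ((W : Set (Fin n))ᶜ) a b))) := by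
  have hR : (prodBernoulli w).real (⋃ v ∈ insert y S, openConn v b) = (prodBernoulli w).real (⋃ v ∈ S, openConn v b) :=
    edgeSw_real_eq_of_sure w s(x, y) hwe _ _ fun ω he => edgeSw_biUnion_insert_iff S x y b hxS hxy ω he
  have hG : (prodBernoulli w).real
        ((openConn d b)ᶜ ∩ (⋃ v ∈ insert y S, openConn d v) ∩ (⋃ v ∈ insert y S, openConn v b))
      = (prodBernoulli w).real ((openConn d b)ᶜ ∩ (⋃ v ∈ S, openConn d v) ∩ (⋃ v ∈ S, openConn v b)) := by
    refine edgeSw_real_eq_of_sure w s(x, y) hwe _ _ fun ω he => ?_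
    simp only [mem_inter_iff]
    rw [edgeSw_biUnion_insert_iff S x y b hxS hxy ω he, edgeSw_biUnion_insert_iff' S x y d hxS hxy ω he]
  have hP : ∀ W ∈ (Finset.univ : Finset (Finset (Fin n))).filter (fun W => Disjoint W A),
      (prodBernoulli w).real {ω : BondConfig (Fin n) | ∀ z : Fin n, (z ∈ W ↔ ω ∈ ⋃ v ∈ insert y S, openConn v z)}
          * A.inf' ⟨b, hb⟩ (fun a => (prodBernoulli w).real (openConnIn ((W : Set (Fin n))ᶜ) a b))
        = (prodBernoulli w).real {ω : BondConfig (Fin n) | ∀ z : Fin n, (z ∈ W ↔ ω ∈ ⋃ v ∈ S, openConn v z)}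
          * A.inf' ⟨b, hb⟩ (fun a => (prodBernoulli w).real (openConnIn ((W : Set (Fin n))ᶜ) a b)) := by
    intro W _
    congr 1
    refine edgeSw_real_eq_of_sure w s(x, y) hwe _ _ fun ω he => ?_
    simp only [mem_setOf_eq]
    refine forall_congr' fun z => ?_
    rw [edgeSw_biUnion_insert_iff S x y z hxS hxy ω he]
  rw [hR, hG, Finset.sum_congr rfl hP] at h
  exact h

/-- **Block goodness from the two one-edge layers.**  For `e = s(x,y)`, `x ∈ S ∌ y`:
`BG(u[e↦0], S, d) ∧ BG(u[e↦0], insert y S, d) → BG(u, S, d)`.  [cite: KozmaNitzan2024, §3.2 pp. 12–14, §5.3 p. 34] -/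
theorem blockGood_of_edgeLayers (u : Sym2 (Fin n) → unitInterval) (A S : Finset (Fin n)) (b d x y : Fin n)
    (hb : b ∈ A) (hxS : x ∈ S) (hyS : y ∉ S)
    (h0 : (prodBernoulli (Function.update u s(x, y) 0)).real (openConn d b)
          + (prodBernoulli (Function.update u s(x, y) 0)).real
              ((openConn d b)ᶜ ∩ (⋃ v ∈ S, openConn d v) ∩ (⋃ v ∈ S, openConn v b))
        ≤ (prodBernoulli (Function.update u s(x, y) 0)).real (⋃ v ∈ S, openConn v b)
          + (∑ W ∈ (Finset.univ : Finset (Finset (Fin n))).filter (fun W => Disjoint W A),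
              (prodBernoulli (Function.update u s(x, y) 0)).real
                  {ω : BondConfig (Fin n) | ∀ z : Fin n, (z ∈ W ↔ ω ∈ ⋃ v ∈ S, openConn v z)}
                * A.inf' ⟨b, hb⟩ (fun a => (prodBernoulli (Function.update u s(x, y) 0)).real
                    (openConnIn ((W : Set (Fin n))ᶜ) a b))))
    (h1 : (prodBernoulli (Function.update u s(x, y) 0)).real (openConn d b)
          + (prodBernoulli (Function.update u s(x, y) 0)).real
              ((openConn d b)ᶜ ∩ (⋃ v ∈ insert y S, openConn d v) ∩ (⋃ v ∈ insert y S, openConn v b))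
        ≤ (prodBernoulli (Function.update u s(x, y) 0)).real (⋃ v ∈ insert y S, openConn v b)
          + (∑ W ∈ (Finset.univ : Finset (Finset (Fin n))).filter (fun W => Disjoint W A),
              (prodBernoulli (Function.update u s(x, y) 0)).real
                  {ω : BondConfig (Fin n) | ∀ z : Fin n, (z ∈ W ↔ ω ∈ ⋃ v ∈ insert y S, openConn v z)}
                * A.inf' ⟨b, hb⟩ (fun a => (prodBernoulli (Function.update u s(x, y) 0)).real
                    (openConnIn ((W : Set (Fin n))ᶜ) a b)))) :
    (prodBernoulli u).real (openConn d b)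
          + (prodBernoulli u).real
              ((openConn d b)ᶜ ∩ (⋃ v ∈ S, openConn d v) ∩ (⋃ v ∈ S, openConn v b))
        ≤ (prodBernoulli u).real (⋃ v ∈ S, openConn v b)
          + (∑ W ∈ (Finset.univ : Finset (Finset (Fin n))).filter (fun W => Disjoint W A),
              (prodBernoulli u).real
                  {ω : BondConfig (Fin n) | ∀ z : Fin n, (z ∈ W ↔ ω ∈ ⋃ v ∈ S, openConn v z)}
                * A.inf' ⟨b, hb⟩ (fun a => (prodBernoulli u).real (openConnIn ((W : Set (Fin n))ᶜ) a b))) := by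
  have hxy : x ≠ y := fun h => hyS (h ▸ hxS)
  -- move the `insert y S` layer from `u[e↦0]` to `u[e↦1]` (they agree off the pairs inside `insert y S`)
  have h1' := blockSlack_eq_of_agree_offBlock (Function.update u s(x, y) 1) (Function.update u s(x, y) 0) A
    (insert y S) b d hb (fun e he => by
      by_cases hee : e = s(x, y)
      · subst hee
        exact absurd ⟨fun z hz => by
          rcases Sym2.mem_iff.1 hz with rfl | rfl
          · exact Finset.mem_insert_of_mem hxS
          · exact Finset.mem_insert_self _ _, by
            rw [Sym2.mk_isDiag_iff]; exact hxy⟩ he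
      · rw [Function.update_of_ne hee, Function.update_of_ne hee]) h1
  -- drop the surely attached vertex `y`
  have h2 := edgeSw_blockSlack_insert_sure (Function.update u s(x, y) 1) A S b d x y hb hxS hxy
    (Function.update_self _ _ _) h1'
  -- combine the two layers
  have hid := edgeSw_slack_decomp u A S b d x y hb hxS
  have ht0 : 0 ≤ (u s(x, y) : ℝ) := (u s(x, y)).2.1
  have ht1 : (u s(x, y) : ℝ) ≤ 1 := (u s(x, y)).2.2
  nlinarith [hid, sub_nonneg.2 h0, sub_nonneg.2 h2, mul_nonneg (sub_nonneg.2 ht1) (sub_nonneg.2 h0),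
    mul_nonneg ht0 (sub_nonneg.2 h2)]

/-- Gluing the empty block changes nothing. [folklore] -/
theorem edgeSw_glue_empty (w : Sym2 (Fin n) → unitInterval) :
    (fun e : Sym2 (Fin n) => if (∀ z ∈ e, z ∈ (∅ : Finset (Fin n))) ∧ ¬ e.IsDiag then (1 : unitInterval) else w e) = w := by
  funext e
  rw [if_neg]
  rintro ⟨h1, -⟩
  induction e using Sym2.ind with
  | h a b => exact Finset.notMem_empty a (h1 a (Sym2.mem_mk_left a b))

/-- **Edge-deletion minimisers are good designations** (mod the inner induction hypothesis).  Let `e = s(x,y)` with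
`x ∈ S ∌ y`, `S` disjoint from `A ∋ b`, and let `d` satisfy `μ_{u[e↦0]}(d ↔ b) ≤ μ_{u[e↦0]}(a ↔ b)` for all `a ∈ A`.  If every block disjoint from
`A` is `d`-good in `u[e↦0]`, then `S` is `d`-good in `u`.  [cite: KozmaNitzan2024, §3.2 Thms 4–5 pp. 12–14, Lemma 5 p. 13] -/
theorem blockGood_of_edgeMin (u : Sym2 (Fin n) → unitInterval) (A S : Finset (Fin n)) (b d x y : Fin n)
    (hb : b ∈ A) (hSA : Disjoint S A) (hxS : x ∈ S) (hyS : y ∉ S)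
    (hdmin : ∀ a ∈ A, (prodBernoulli (Function.update u s(x, y) 0)).real (openConn d b)
      ≤ (prodBernoulli (Function.update u s(x, y) 0)).real (openConn a b))
    (hIH : ∀ S' : Finset (Fin n), Disjoint S' A →
      (prodBernoulli (Function.update u s(x, y) 0)).real (openConn d b)
          + (prodBernoulli (Function.update u s(x, y) 0)).real
              ((openConn d b)ᶜ ∩ (⋃ v ∈ S', openConn d v) ∩ (⋃ v ∈ S', openConn v b))
        ≤ (prodBernoulli (Function.update u s(x, y) 0)).real (⋃ v ∈ S', openConn v b)
          + (∑ W ∈ (Finset.univ : Finset (Finset (Fin n))).filter (fun W => Disjoint W A),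
              (prodBernoulli (Function.update u s(x, y) 0)).real
                  {ω : BondConfig (Fin n) | ∀ z : Fin n, (z ∈ W ↔ ω ∈ ⋃ v ∈ S', openConn v z)}
                * A.inf' ⟨b, hb⟩ (fun a => (prodBernoulli (Function.update u s(x, y) 0)).real
                    (openConnIn ((W : Set (Fin n))ᶜ) a b)))) :
    (prodBernoulli u).real (openConn d b)
          + (prodBernoulli u).real
              ((openConn d b)ᶜ ∩ (⋃ v ∈ S, openConn d v) ∩ (⋃ v ∈ S, openConn v b))
        ≤ (prodBernoulli u).real (⋃ v ∈ S, openConn v b)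
          + (∑ W ∈ (Finset.univ : Finset (Finset (Fin n))).filter (fun W => Disjoint W A),
              (prodBernoulli u).real
                  {ω : BondConfig (Fin n) | ∀ z : Fin n, (z ∈ W ↔ ω ∈ ⋃ v ∈ S, openConn v z)}
                * A.inf' ⟨b, hb⟩ (fun a => (prodBernoulli u).real (openConnIn ((W : Set (Fin n))ᶜ) a b))) := by
  refine blockGood_of_edgeLayers u A S b d x y hb hxS hyS (hIH S hSA) ?_
  by_cases hyA : y ∈ A
  · -- relay layer: Kozma–Nitzan Lemma 5 in block form; the pockets are non-negative
    have h5 := relayNoDrift_designated_le_reach (Function.update u s(x, y) 0) ∅ (insert y S) d y b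
      (Finset.empty_subset _) (Finset.mem_insert_self y S) (hdmin y hyA)
    rw [edgeSw_glue_empty] at h5
    have hpk : 0 ≤ (∑ W ∈ (Finset.univ : Finset (Finset (Fin n))).filter (fun W => Disjoint W A),
              (prodBernoulli (Function.update u s(x, y) 0)).real
                  {ω : BondConfig (Fin n) | ∀ z : Fin n, (z ∈ W ↔ ω ∈ ⋃ v ∈ insert y S, openConn v z)}
                * A.inf' ⟨b, hb⟩ (fun a => (prodBernoulli (Function.update u s(x, y) 0)).real
                    (openConnIn ((W : Set (Fin n))ᶜ) a b))) :=
      Finset.sum_nonneg fun W _ => mul_nonneg measureReal_nonneg (Finset.le_inf' _ _ fun a _ => measureReal_nonneg)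
    linarith
  · exact hIH (insert y S) (Finset.disjoint_insert_left.2 ⟨hyA, hSA⟩)

/-- **THE SINGLE-EDGE SWITCH.**  If for some block edge `e = s(x,y)` (`x ∈ S ∌ y`) and some lower bound `d` of
`μ_{u[e↦0]}(· ↔ b)` on `A` (e.g. a minimiser) the designation `a₀` is glued-below `d` (`τ_{u/S}(a₀) ≤ τ_{u/S}(d)`), and every block disjoint from `A`
is `d`-good in `u[e↦0]` (inner induction hypothesis: one positive pair fewer), then `S` is `a₀`-good in `u`.
[cite: KozmaNitzan2024, §3.2 Thms 4–5 pp. 12–14, Question 9 p. 36] -/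
theorem blockGood_of_edgeSwitch (u : Sym2 (Fin n) → unitInterval) (A S : Finset (Fin n)) (b a₀ d x y : Fin n)
    (hb : b ∈ A) (hSA : Disjoint S A) (hxS : x ∈ S) (hyS : y ∉ S)
    (hdmin : ∀ a ∈ A, (prodBernoulli (Function.update u s(x, y) 0)).real (openConn d b)
      ≤ (prodBernoulli (Function.update u s(x, y) 0)).real (openConn a b))
    (hle : (prodBernoulli (fun e : Sym2 (Fin n) => if (∀ z ∈ e, z ∈ S) ∧ ¬ e.IsDiag then 1 else u e)).real (openConn a₀ b)
      ≤ (prodBernoulli (fun e : Sym2 (Fin n) => if (∀ z ∈ e, z ∈ S) ∧ ¬ e.IsDiag then 1 else u e)).real (openConn d b))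
    (hIH : ∀ S' : Finset (Fin n), Disjoint S' A →
      (prodBernoulli (Function.update u s(x, y) 0)).real (openConn d b)
          + (prodBernoulli (Function.update u s(x, y) 0)).real
              ((openConn d b)ᶜ ∩ (⋃ v ∈ S', openConn d v) ∩ (⋃ v ∈ S', openConn v b))
        ≤ (prodBernoulli (Function.update u s(x, y) 0)).real (⋃ v ∈ S', openConn v b)
          + (∑ W ∈ (Finset.univ : Finset (Finset (Fin n))).filter (fun W => Disjoint W A),
              (prodBernoulli (Function.update u s(x, y) 0)).real
                  {ω : BondConfig (Fin n) | ∀ z : Fin n, (z ∈ W ↔ ω ∈ ⋃ v ∈ S', openConn v z)}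
                * A.inf' ⟨b, hb⟩ (fun a => (prodBernoulli (Function.update u s(x, y) 0)).real
                    (openConnIn ((W : Set (Fin n))ᶜ) a b)))) :
    (prodBernoulli u).real (openConn a₀ b)
          + (prodBernoulli u).real
              ((openConn a₀ b)ᶜ ∩ (⋃ v ∈ S, openConn a₀ v) ∩ (⋃ v ∈ S, openConn v b))
        ≤ (prodBernoulli u).real (⋃ v ∈ S, openConn v b)
          + (∑ W ∈ (Finset.univ : Finset (Finset (Fin n))).filter (fun W => Disjoint W A),
              (prodBernoulli u).real
                  {ω : BondConfig (Fin n) | ∀ z : Fin n, (z ∈ W ↔ ω ∈ ⋃ v ∈ S, openConn v z)}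
                * A.inf' ⟨b, hb⟩ (fun a => (prodBernoulli u).real (openConnIn ((W : Set (Fin n))ᶜ) a b))) :=
  blockGood_mono_designated u A S b a₀ d hb hle (blockGood_of_edgeMin u A S b d x y hb hSA hxS hyS hdmin hIH)

end EdgeSwitch

end

end Summit.CriticalPhenomena.PercolationContinuityZ3.Theorems
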